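import Literature.MathematicalPhysics.QuantumFieldTheory.Balaban1983to89.B1TorusCubeBoxOp
import Literature.MathematicalPhysics.QuantumFieldTheory.Balaban1983to89.B1Ineq225DerivZeroFieldTorus
import Literature.MathematicalPhysics.QuantumFieldTheory.Balaban1983to89.B1Eq31Concrete
import Literature.MathematicalPhysics.QuantumFieldTheory.Balaban1983to89.B2Prop22Proof
import Literature.MathematicalPhysics.QuantumFieldTheory.Balaban1983to89.B1Ineq367SmallFieldTorus

/-!
# `Balaban1983to89.B1Ineq225BackgroundTorus` — T. Bałaban, *(Higgs)₂,₃ quantum fields in a finite volume. I. A lower bound*,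
# Commun. Math. Phys. **85** (1982) 603–626 [Balaban1982Higgs1], Prop. 2.1 (2.25) VALUE CLAUSE, SUP FORM, ON `Ω = T_ε` AT THE REGULAR
# BACKGROUND FIELD `A^{(K),ε} ≠ 0` OF (3.29) — `‖G^ε_K(T_ε, A^{(K),ε})g‖_∞ ≦ c₀(L^Kε)²‖g‖_∞` — PROVED FOR THE (Higgs)₂,₃ CARRIER from
# B4's Theorem (1.10) = [Balaban1983RegularityDecay] by the random-walk expansion §2 ON THE TORUS (p35's `B1TorusCubeLocality26`,
# `B1TorusCubeBoxOp.cube_inputs`) and the (2.23)-regularity of `A^{(K),ε} = a_K(L^Kε)^{−2}G^ε_K(0)Q_K^*A` (p14's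
# `B1Ineq225DerivZeroFieldTorus.covDeriv_propagatorK_sup_bound`): the hypothesis `hGs` of p14's `B1Ineq367SmallFieldTorus`.

statement-level skeleton of published theorems with citation tags; proofs where landed; nothing here is a claim about the Yang–Mills mass gap

PDF held: `paper:balaban1982-cmp85-higgs23-i` p. 610 [PDF 8] (Prop. 2.1, (2.23)–(2.25)), p. 617 [PDF 15] ((3.29)); `paper:balaban1983-cmp89-
regularity-decay` p. 573 [PDF 3] (Theorem (1.10): *"for e sufficiently small and for a regular vector field A"*), pp. 575–578 [PDF 5–8] (§2).

CITATION HEADER (lean-in-tree rule).  Cell `lit-balaban` (HOME `run/shared/lean/pub/lit-balaban/`), Phase-2 proof seat **p35** gen 8 (unit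
`lit-balaban-p35`); SKELETON rows **B1.Prop2.1** ((2.25) value clause, sup form, `A = A^{(K),ε} ≠ 0`, `Ω = T_ε`: MODEL INSTANCE) and
**B4.Thm@573** ((1.10) value member on the torus at a regular background).  USED BY NAME, never restated: this seat's `B1TorusCubeCover`,
`B1TorusCubeLocality26.norm_propagatorK_univ_le`, `B1TorusCubeChart`, `B1TorusCubeBoxOp.{acT, cube_inputs}`; p14's
`B1Ineq225DerivZeroFieldTorus.covDeriv_propagatorK_sup_bound`, `B1Ineq367SmallFieldTorus.chiW_eq_one_of_smallSet_torus_unif`,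
`B1Eq211ZeroFieldTorus.Shape`, `B1Ineq326HiggsModel.chiW`, `B1Ineq368BoxBound.smallSet`; p23/r15's `B1Eq31Concrete.{bgVec, toSite_bgVec}`,
`B3MultiscaleFields.{toSite, zeroCharge}`, `B2Prop22Proof.norm_avgQkAdj_apply`; the typer's `HiggsLattice.{sderiv, covDeriv_zero}`,
`HiggsCovariance.propagatorK`, `B1.{aSeq_pos, aSeq_le}`.

WHAT IS PRINTED (verbatim, p. 610 [PDF 8]).  *"Proposition 2.1. Let a set Ω satisfies Ω = B^k(Ω^{(k)}) and let Ω^{(k)} ⊂ T^{(k)}_1 be a sum of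
big blocks with M sufficiently large. Further, let a configuration A be regular on Ω in the sense that |(∂^η_μA^η_ν)(x)| ≦ c e(L^kε)^{β−1}, x ∈ Ω,
μ = 1,…,d, (2.23) where e(L^kε) = e(L^kε)^{(4−d)/2}, η = L^{−k}, β > 0 … Then for e(L^kε) sufficiently small and α < 1 there exist positive
constants δ₀, c₀, R₀ independent of A, k, Ω … such that … |(G_k(Ω,A)f)(x)| ≦ c₀exp(−δ₀dist(x,supp f))‖f‖_∞ (2.25)"*; p. 617 [PDF 15], (3.29):
*"A^{(k),ε} = a_k(L^kε)^{−2}G^ε_kQ^*_kA"*.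

WHAT THIS FILE PROVES (kernel-checked, zero `sorry`, theorems only; axioms standard).
* §1 `apply_shift_sub_eq` ((1.4): `A_ν(x+εe_μ) − A_ν(x) = ε(∂^εA)_ν(⟨x,μ⟩)`), `abs_apply_le_norm`, `sderiv_smul`, `norm_sderiv_bgVec_le` — THE
  (2.23)-TYPE REGULARITY OF THE BACKGROUND (3.29): `‖∂^εA^{(K),ε}(b)‖ ≦ a·c₀′·(L^Kε)^{−1}·r` whenever `|A| ≦ r` (p14's derivative clause of
  (2.25) at zero field for the vector propagator `G^ε_K(0)`, `‖Q_K^*A‖_∞ = ‖A‖_∞`, `a_K ≦ a`).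
* §2 **(2.25) VALUE CLAUSE, SUP FORM, ON `T_ε` AT `A^{(K),ε}`** — `norm_propagatorK_bgVec_le_of_cubes`: for `d ≧ 1`, odd `L > 1`, `a > 0`,
  `μ₀² > 0`, `m² > 0`, `N`, `(e,q)` and a mesh cap `ε₀` there are `c₀ > 0`, `K₀min` and thresholds `c_A(K₀) > 0` such that for every cube
  size `K₀ ≧ K₀min`, on every torus of the sub-family `M·L′_μ = L^m` with `K₀ ∣ M`, at every level `1 ≦ K ≦ K_P` whose cubes are not the
  whole torus (`3·L^KK₀ ≦ |T_ε|_μ`) and with `L^Kε ≦ ε₀`, for every `r` with `r·(L^Kε) ≦ c_A(K₀)` (*"e(L^kε) sufficiently small"* for a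
  background of size `r`) and every `A` on `T^{(K)}` with `|A(x)| ≦ r`: `‖(G^ε_K(T_ε, A^{(K),ε})g)(x)‖ ≦ c₀(L^Kε)²‖g‖_∞` — EXACTLY the
  hypothesis `hGs` of p14's `B1Ineq367SmallFieldTorus.chiW_eq_one_of_smallSet_torus_at` (there `r ≦ c₁^{−1}(L^Kε)^{−(d−2)/2}p_K`, so
  `r·L^Kε ≦ c_A` reads `c₁^{−1}(L^Kε)^{(4−d)/2}p_K ≦ c_A`: small `L^Kε` for `d ≦ 3`).  Two packagings of the cube condition:
  `norm_propagatorK_bgVec_le` (`K₀ ∣ M`, `3K₀ ≦ 2M`) and `norm_propagatorK_bgVec_le_bigBlocks` (BAŁABAN'S OWN CUBES `K₀ = M`: *"M sufficiently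
  large"* = `M ≧ M_min`, threshold `c_A(M)`, and `K < K_P ∨ L′_μ ≧ 2`).
* §3 **`chiW_eq_one_of_smallSet_bgVec` — (3.67)/(E3) with BOTH halves discharged**: p14's `B1Ineq367SmallFieldTorus.chiW_eq_one_of_smallSet_torus_unif`
  fed with §2: under the same side conditions and `L^Kε ≦ 1`, for all `ℓ, p` with `ℓ_K = L^Kε` and every `r ≦ c₁^{−1}(L^Kε)^{−(d−2)/2}p_K`,
  `c₁ = a(c₀+1+(μ₀²+m²)c₀+ac₀)`, with `r·L^Kε ≦ c_A(K₀)`: `χ_K(A)χ_K(φ) = 1` on `S_r` (the field `hE3` of `B1LowerBound114Model.Inputs`).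
HONEST SCOPE: sup form of the value clause only (no `exp(−δ₀dist)` factor, no derivative/Hölder clause (2.24)); `Ω = T_ε`; tori with
`M·L′_μ = L^m`, `L` odd, cube conditions as stated; constants existential (functions of `d, L, a, μ₀², m²ε₀², N, (e,q)`; `c_A` also of the
cube size).
Unit `lit-balaban-p35` gen 8 (literature-prover-lit-balaban-p35-g8-0).
-/

open scoped BigOperators
open Matrix

namespace Literature.MathematicalPhysics.QuantumFieldTheory.Balaban1983to89.B1Ineq225BackgroundTorus

open Literature.MathematicalPhysics.QuantumFieldTheory.Balaban1983to89.HiggsLattice (ChargeData sderiv covDeriv covDeriv_zero)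
open Literature.MathematicalPhysics.QuantumFieldTheory.Balaban1983to89.HiggsCovariance (propagatorK covOpK avgQkAdj)
open Literature.MathematicalPhysics.QuantumFieldTheory.Balaban1983to89.B3MultiscaleFields (toSite zeroCharge)
open Literature.MathematicalPhysics.QuantumFieldTheory.Balaban1983to89.B1Eq31Concrete (bgVec toSite_bgVec thrF)
open Literature.MathematicalPhysics.QuantumFieldTheory.Balaban1983to89.B1Ineq326HiggsModel (chiW)
open Literature.MathematicalPhysics.QuantumFieldTheory.Balaban1983to89.B1Ineq368BoxBound (smallSet)
open Literature.MathematicalPhysics.QuantumFieldTheory.Balaban1983to89.B1Ineq367SmallFieldTorus (chiW_eq_one_of_smallSet_torus_unif)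
open Literature.MathematicalPhysics.QuantumFieldTheory.Balaban1983to89.B1Eq211ZeroFieldTorus (Shape)
open Literature.MathematicalPhysics.QuantumFieldTheory.Balaban1983to89.B1Ineq225DerivZeroFieldTorus (covDeriv_propagatorK_sup_bound)
open Literature.MathematicalPhysics.QuantumFieldTheory.Balaban1983to89.B2Prop22Proof (norm_avgQkAdj_apply)
open Literature.MathematicalPhysics.QuantumFieldTheory.Balaban1983to89.B1TorusCubeCover (half Lab cube hTor)
open Literature.MathematicalPhysics.QuantumFieldTheory.Balaban1983to89.B1TorusCubeLocality26 (cubeVec norm_propagatorK_univ_le)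
open Literature.MathematicalPhysics.QuantumFieldTheory.Balaban1983to89.B1TorusCubeChart (dd dd_succ castD toT toT_add_e1)
open Literature.MathematicalPhysics.QuantumFieldTheory.Balaban1983to89.B1TorusCubeBoxOp (acT cube_inputs)
open Literature.MathematicalPhysics.QuantumFieldTheory.Balaban1983to89.B4Lemma22ReduceZero (Box)
open Literature.MathematicalPhysics.QuantumFieldTheory.Balaban1983to89.B4Lower18Regular (e1)

variable {P : HiggsLattice.Params}

/-! ## §1 The (2.23)-type regularity of the background field (3.29) -/

section Regularity

/-- **(1.4)**: `A_ν(x+εe_μ) − A_ν(x) = ε·(∂^εA)_ν(⟨x, μ⟩)` for a vector field read as an `ℝ^d`-valued site function. [cite: Balaban1982Higgs1, (1.4) p.604] -/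
theorem apply_shift_sub_eq (A : HiggsLattice.VecField P 0) (x : HiggsLattice.Site P 0) (μ ν : Fin P.d) :
    A ⟨x.shift μ, ν⟩ - A ⟨x, ν⟩ = P.mesh 0 * (sderiv (toSite A) ⟨x, μ⟩) ν := by
  have hε : P.mesh 0 ≠ 0 := (P.mesh_pos 0).ne'
  unfold sderiv toSite HiggsLattice.PBond.tgt
  rw [PiLp.smul_apply, PiLp.sub_apply, PiLp.toLp_apply, PiLp.toLp_apply, smul_eq_mul, ← mul_assoc, mul_inv_cancel₀ hε, one_mul]

/-- A component is bounded by the Euclidean norm. [folklore] -/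
private theorem abs_apply_le_norm {n : ℕ} (v : EuclideanSpace ℝ (Fin n)) (i : Fin n) : |v i| ≤ ‖v‖ := by
  rw [EuclideanSpace.norm_eq]
  refine Real.le_sqrt_of_sq_le ?_
  rw [show |v i| = ‖v i‖ from (Real.norm_eq_abs _).symm]
  exact Finset.single_le_sum (f := fun j => ‖v j‖ ^ 2) (fun j _ => sq_nonneg _) (Finset.mem_univ i)

/-- `∂^ε` is linear: `∂^ε(c·f) = c·∂^εf`. [cite: Balaban1982Higgs1, (1.4) p.604] -/
theorem sderiv_smul {n : ℕ} (c : ℝ) (f : HiggsLattice.ScalarField P 0 n) (b : HiggsLattice.PBond P 0) :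
    sderiv (c • f) b = c • sderiv f b := by
  unfold sderiv
  rw [Pi.smul_apply, Pi.smul_apply, ← smul_sub, smul_comm]

/-- **THE REGULARITY OF THE BACKGROUND (3.29)**: `‖∂^εA^{(K),ε}(b)‖ ≦ a·c·(L^Kε)^{−1}·r` for `|A| ≦ r`, GIVEN the zero-field derivative bound
`‖D^ε_0G^ε_K(0)ψ‖_∞ ≦ c(L^Kε)‖ψ‖_∞` for the vector propagator (p14) — with `‖Q_K^*A‖_∞ = ‖A‖_∞` and `a_K ≦ a`.
[cite: Balaban1982Higgs1, (2.23) p.610, (3.29) p.617, (2.15) p.609] -/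
theorem norm_sderiv_bgVec_le {K : ℕ} (hK1 : 1 ≤ K) (hL1 : (1 : ℝ) < P.L) {a mu0sq : ℝ} (ha : 0 < a) {c r : ℝ}
    (hD : ∀ (ψ : HiggsLattice.ScalarField P 0 P.d) (M : ℝ), (∀ x, ‖ψ x‖ ≤ M) → ∀ b : HiggsLattice.PBond P 0,
      ‖covDeriv (zeroCharge P.d) (0 : HiggsLattice.VecField P 0)
        (propagatorK (zeroCharge P.d) Finset.univ (0 : HiggsLattice.VecField P 0) mu0sq a K ψ) b‖ ≤ c * P.mesh K * M)
    (A : HiggsLattice.VecField P K) (hA : ∀ x, ‖toSite A x‖ ≤ r) (b : HiggsLattice.PBond P 0) :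
    ‖sderiv (toSite (bgVec mu0sq a K A)) b‖ ≤ a * c * (P.mesh K)⁻¹ * r := by
  have hmesh : 0 < P.mesh K := P.mesh_pos K
  have haK0 : 0 < B1.aSeq a P.L K := B1.aSeq_pos ha hL1 hK1
  have haK : B1.aSeq a P.L K ≤ a := B1.aSeq_le ha hL1 K hK1
  rw [toSite_bgVec, sderiv_smul, norm_smul, Real.norm_eq_abs, abs_of_nonneg (by positivity), ← covDeriv_zero (zeroCharge P.d)]
  have hψ : ∀ x, ‖avgQkAdj (zeroCharge P.d) (0 : HiggsLattice.VecField P 0) K (toSite A) x‖ ≤ r := fun x => by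
    rw [norm_avgQkAdj_apply]; exact hA _
  have h := hD _ r hψ b
  calc B1.aSeq a P.L K * (P.mesh K ^ 2)⁻¹ * ‖covDeriv (zeroCharge P.d) (0 : HiggsLattice.VecField P 0)
        (propagatorK (zeroCharge P.d) Finset.univ (0 : HiggsLattice.VecField P 0) mu0sq a K
          (avgQkAdj (zeroCharge P.d) (0 : HiggsLattice.VecField P 0) K (toSite A))) b‖
      ≤ a * (P.mesh K ^ 2)⁻¹ * (c * P.mesh K * r) :=
        mul_le_mul (mul_le_mul_of_nonneg_right haK (by positivity)) h (norm_nonneg _) (by positivity)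
    _ = a * c * (P.mesh K)⁻¹ * r := by field_simp

end Regularity

/-! ## §2 (2.25), value clause, sup form, on `T_ε` at the background `A^{(K),ε}` -/

section Main

/-- `3K₀ ≦ 2M` gives `3·(L^KK₀) ≦ |T_ε|_μ` at every level `K ≦ K_P`. [cite: Balaban1982Higgs1, (1.2) p.604] -/
theorem three_half_le_sites {K K₀ : ℕ} (hK : K ≤ P.K) (h3 : 3 * K₀ ≤ 2 * P.M) (μ : Fin P.d) :
    3 * half P K K₀ ≤ P.sitesPerDir 0 μ := by
  unfold half HiggsLattice.Params.sitesPerDir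
  have hLp := P.hLp μ
  have hpow : P.L ^ K ≤ P.L ^ (P.K - 0) := Nat.pow_le_pow_right P.hL (by omega)
  calc 3 * (P.L ^ K * K₀) = P.L ^ K * (3 * K₀) := by ring
    _ ≤ P.L ^ (P.K - 0) * (2 * P.M * P.Lp μ) := Nat.mul_le_mul hpow (by nlinarith)
    _ = 2 * (P.L ^ (P.K - 0) * P.M * P.Lp μ) := by ring

set_option maxHeartbeats 400000 in
/-- **PROP. 2.1 (2.25), VALUE CLAUSE, SUP FORM, ON `Ω = T_ε` AT THE BACKGROUND `A^{(K),ε}` OF (3.29) — B4's THEOREM (1.10) VALUE MEMBER FOR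
THE (Higgs)₂,₃ CARRIER AT A REGULAR `A ≠ 0`.**  For `d ≧ 1`, odd `L > 1`, `a > 0`, `μ₀² > 0`, `m² > 0`, `N`, `(e, q)` and a mesh cap `ε₀`:
constants `c₀ > 0`, `K₀min`, and for every cube size `K₀ ≧ K₀min` a background threshold `c_A > 0`, such that on every torus of the
sub-family `M·L′_μ = L^m` with `K₀ ∣ M`, `3K₀ ≦ 2M`, at every level `1 ≦ K ≦ K_P` with `L^Kε ≦ ε₀`, for every `r` with `r·L^Kε ≦ c_A`, every
`A` on `T^{(K)}` with `|A(x)| ≦ r`, every `g` with `‖g‖_∞ ≦ M′` and every `x`: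
`‖(G^ε_K(T_ε, A^{(K),ε})g)(x)‖ ≦ c₀(L^Kε)²M′`.  Proof = [B4] §2 on the torus: `B1TorusCubeLocality26.norm_propagatorK_univ_le` fed with
`B1TorusCubeBoxOp.cube_inputs` (charge `e_c = e₁`, regularity pair `(c, β) = (1, ½)`), the regularity (2.23) of `A^{(K),ε}` being
`norm_sderiv_bgVec_le`. [cite: Balaban1982Higgs1, Prop. 2.1 (2.25) p.610; (3.29) p.617]
[cite: Balaban1983RegularityDecay, Theorem (1.10) p.573; §2 pp.575–578] -/
theorem norm_propagatorK_bgVec_le_of_cubes (d L : ℕ) (hd : 1 ≤ d) (hL : Odd L ∧ 1 < L) {a : ℝ} (ha : 0 < a)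
    {mu0sq msq : ℝ} (hmu : 0 < mu0sq) (hmsq : 0 < msq) (N : ℕ) (C : ChargeData N) (ε₀ : ℝ) :
    ∃ c₀ : ℝ, 0 < c₀ ∧ ∃ K₀min : ℕ, ∃ cA : ℕ → ℝ, (∀ K₀, 0 < cA K₀) ∧ ∀ K₀ : ℕ, K₀min ≤ K₀ →
      ∀ (P : HiggsLattice.Params) (_S : Shape P), P.d = d → P.L = L → K₀ ∣ P.M →
      ∀ {K : ℕ}, 1 ≤ K → K ≤ P.K → (∀ μ, 3 * half P K K₀ ≤ P.sitesPerDir 0 μ) → P.mesh K ≤ ε₀ →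
      ∀ {r : ℝ}, r * P.mesh K ≤ cA K₀ →
      ∀ A : HiggsLattice.VecField P K, (∀ x, ‖toSite A x‖ ≤ r) →
        ∀ (g : HiggsLattice.ScalarField P 0 N) (M : ℝ), (∀ x, ‖g x‖ ≤ M) →
          ∀ x, ‖propagatorK C Finset.univ (bgVec mu0sq a K A) msq a K g x‖ ≤ c₀ * P.mesh K ^ 2 * M := by
  have hℓ0 : 1 ≤ L - 1 := by have := hL.2; omega
  -- the constants of the cube inputs (Lemma 2.2 at charge 1) and of the zero-field derivative clause for the vector propagator
  obtain ⟨Cγ, Cβ, hCγ, hCβ, hci⟩ := cube_inputs C (d - 1) (L - 1) hℓ0 a a (msq * ε₀ ^ 2) ha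
  obtain ⟨c', hc', hder⟩ := covDeriv_propagatorK_sup_bound d L d hd hL ha hmu.le ε₀
  -- the charge threshold `e₁(K₀)` of the cube inputs for the regularity pair `(1, ½)`, as a function of the cube size
  have hci' : ∀ K₀ : ℕ, ∃ e₁ : ℝ, 0 < e₁ ∧ _ := fun K₀ => hci 1 (1 / 2) zero_le_one (by norm_num) (max K₀ 8) (le_max_right _ _)
  choose e₁ he₁ hthr' using hci'
  refine ⟨2 * 2 ^ d * Cγ, by positivity, max 8 (⌈(2 : ℝ) ^ (d + 1) * Cβ⌉₊),
    fun K₀ => Real.sqrt (e₁ K₀) / (|C.e| * a * c' + 1), fun K₀ => by have := he₁ K₀; positivity, fun K₀ hK₀ => ?_⟩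
  have hK₀8 : 8 ≤ K₀ := le_trans (le_max_left _ _) hK₀
  have hK₀C : (2 : ℝ) ^ (d + 1) * Cβ ≤ K₀ :=
    (Nat.le_ceil _).trans (by exact_mod_cast le_trans (le_max_right _ _) hK₀)
  have hmax : max K₀ 8 = K₀ := max_eq_left hK₀8
  have hthr := hthr' K₀
  rw [hmax] at hthr
  intro P S hPd hPL hK₀M K hK1 hK hN3 hε r hr A hA g M hg x
  subst hPd
  have he₁K := he₁ K₀
  have hL1 : (1 : ℝ) < P.L := by rw [hPL]; exact_mod_cast hL.2
  have hL2 : 2 ≤ P.L := by rw [hPL]; exact hL.2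
  have hdd : dd P = P.d - 1 := rfl
  have hPL1 : P.L - 1 = L - 1 := by rw [hPL]
  have hmesh : 0 < P.mesh K := P.mesh_pos K
  have hmesh0 : 0 < P.mesh 0 := P.mesh_pos 0
  have hε0 : 0 ≤ ε₀ := hmesh.le.trans hε
  have hcap : msq * P.mesh K ^ 2 ≤ msq * ε₀ ^ 2 :=
    mul_le_mul_of_nonneg_left (pow_le_pow_left₀ hmesh.le hε 2) hmsq.le
  have hakP : 0 ≤ B1.aSeq a P.L K := (B1.aSeq_pos ha hL1 hK1).le
  have hM0 : 0 ≤ M := (norm_nonneg _).trans (hg x)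
  have hr0 : 0 ≤ r := (norm_nonneg _).trans (hA (HiggsAveraging.blockIter K x))
  set Abg : HiggsLattice.VecField P 0 := bgVec mu0sq a K A with hAbg
  -- the regularity (2.23) of the background in the lineage's (1.7) form, at charge `e_c = e₁`, pair `(1, ½)`
  have hnR : ((((P.L - 1 + 1) ^ K : ℕ)) : ℝ) = (P.L : ℝ) ^ K := by
    rw [B1TorusCubeChart.predL_succ, Nat.cast_pow]
  have hmeshK : P.mesh K = (P.L : ℝ) ^ K * P.mesh 0 := by
    unfold HiggsLattice.Params.mesh; ring
  have hD' := norm_sderiv_bgVec_le hK1 hL1 ha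
    (fun ψ M' hψ b => hder P S rfl hPL (zeroCharge P.d) hK1 hK hε ψ M' hψ b) A hA
  have h17 : ∀ (j : Lab P K K₀), ∀ y ∈ Box (dd P) (P.L - 1) K (B1TorusCubeChart.M2 P K₀), ∀ i i' : Fin (dd P + 1),
      |acT K K₀ j ((((P.L - 1 + 1) ^ K : ℕ) : ℝ) * P.mesh 0 * C.e / e₁ K₀) Abg (y + e1 i) i'
        - acT K K₀ j ((((P.L - 1 + 1) ^ K : ℕ) : ℝ) * P.mesh 0 * C.e / e₁ K₀) Abg y i'|
        ≤ 1 * e₁ K₀ ^ ((1 : ℝ) / 2 - 1) / ((P.L - 1 + 1) ^ K : ℕ) := by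
    intro j y _ i i'
    unfold acT
    rw [toT_add_e1, ← mul_sub, abs_mul, apply_shift_sub_eq, hnR]
    have hsd := (abs_apply_le_norm _ (castD P i')).trans (hD' ⟨toT K K₀ j y, castD P i⟩)
    -- `|σ|·ε·|∂A| ≦ (L^K·ε·|e|/e₁)·ε·(a c′ r/(L^Kε)) = ε|e|a c′ r/e₁ ≦ e₁^{−1/2}/L^K`
    have hpow : (0 : ℝ) < (P.L : ℝ) ^ K := by positivity
    have hσ : |(P.L : ℝ) ^ K * P.mesh 0 * C.e / e₁ K₀| = (P.L : ℝ) ^ K * P.mesh 0 * |C.e| / e₁ K₀ := by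
      rw [abs_div, abs_mul, abs_mul, abs_of_pos hpow, abs_of_pos hmesh0, abs_of_pos he₁K]
    rw [hσ, abs_mul, abs_of_pos hmesh0]
    have hexp : e₁ K₀ ^ ((1 : ℝ) / 2 - 1) = (Real.sqrt (e₁ K₀))⁻¹ := by
      rw [show (1 : ℝ) / 2 - 1 = -(1 / 2) by norm_num, Real.rpow_neg he₁K.le, Real.sqrt_eq_rpow]
    rw [hexp, one_mul]
    -- the key smallness: `r·L^Kε·(|e| a c′) ≦ √e₁`, from `r·L^Kε ≦ c_A`
    have hkey : r * P.mesh K * (|C.e| * a * c') ≤ Real.sqrt (e₁ K₀) := by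
      have h1 : r * P.mesh K * (|C.e| * a * c') ≤ r * P.mesh K * (|C.e| * a * c' + 1) :=
        mul_le_mul_of_nonneg_left (by linarith) (by positivity)
      refine h1.trans ?_
      have hr' := hr
      simp only at hr'
      rw [le_div_iff₀ (by positivity)] at hr'
      exact hr'
    calc (P.L : ℝ) ^ K * P.mesh 0 * |C.e| / e₁ K₀ * (P.mesh 0 * |(sderiv (toSite Abg) ⟨toT K K₀ j y, castD P i⟩) (castD P i')|)
        ≤ (P.L : ℝ) ^ K * P.mesh 0 * |C.e| / e₁ K₀ * (P.mesh 0 * (a * c' * (P.mesh K)⁻¹ * r)) :=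
          mul_le_mul_of_nonneg_left (mul_le_mul_of_nonneg_left hsd hmesh0.le) (by positivity)
      _ = (r * P.mesh K * (|C.e| * a * c')) / (e₁ K₀ * (P.L : ℝ) ^ K) := by
          rw [hmeshK]; field_simp
      _ ≤ Real.sqrt (e₁ K₀) / (e₁ K₀ * (P.L : ℝ) ^ K) := div_le_div_of_nonneg_right hkey (by positivity)
      _ = (Real.sqrt (e₁ K₀))⁻¹ / ((P.L : ℝ) ^ K) := by
          rw [← Real.sqrt_div_self, div_div]
  -- the per-cube inputs, then the random-walk sum on the torus
  have hcube := fun j : Lab P K K₀ =>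
    hthr P hdd hPL1 K hK1 hK hK₀M hN3 a msq le_rfl le_rfl hmsq hcap j Abg (e₁ K₀) he₁K le_rfl (h17 j)
  have hsmall : (2 : ℝ) ^ P.d * (Cβ / K₀) ≤ 1 / 2 := by
    have hK₀pos : (0 : ℝ) < K₀ := by exact_mod_cast (show 0 < K₀ by omega)
    rw [pow_succ] at hK₀C
    rw [← mul_div_assoc, div_le_iff₀ hK₀pos]
    linarith
  have hmain := norm_propagatorK_univ_le C hK hK₀M hK₀8 hmsq a hakP Abg (γ := Cγ * P.mesh K ^ 2) (β := Cβ / K₀)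
    (by positivity) (by positivity) (fun j ψ => (hcube j).1 ψ) (fun j ψ => (hcube j).2 ψ) hsmall g
  have hg' : ‖g‖ ≤ M := (pi_norm_le_iff_of_nonneg hM0).2 hg
  calc ‖propagatorK C Finset.univ Abg msq a K g x‖ ≤ ‖propagatorK C Finset.univ Abg msq a K g‖ := norm_le_pi_norm _ x
    _ ≤ 2 * 2 ^ P.d * (Cγ * P.mesh K ^ 2) * ‖g‖ := hmain
    _ ≤ 2 * 2 ^ P.d * (Cγ * P.mesh K ^ 2) * M := mul_le_mul_of_nonneg_left hg' (by positivity)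
    _ = 2 * 2 ^ P.d * Cγ * P.mesh K ^ 2 * M := by ring

/-- **THE SAME, WITH THE CUBE CONDITION AS «`K₀ ∣ M`, `3K₀ ≦ 2M`»** (then `3·L^KK₀ ≦ |T_ε|_μ` at every level): the form announced
in the header. [cite: Balaban1982Higgs1, Prop. 2.1 (2.25) p.610; (3.29) p.617] [cite: Balaban1983RegularityDecay, Theorem (1.10) p.573] -/
theorem norm_propagatorK_bgVec_le (d L : ℕ) (hd : 1 ≤ d) (hL : Odd L ∧ 1 < L) {a : ℝ} (ha : 0 < a) {mu0sq msq : ℝ}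
    (hmu : 0 < mu0sq) (hmsq : 0 < msq) (N : ℕ) (C : ChargeData N) (ε₀ : ℝ) :
    ∃ c₀ : ℝ, 0 < c₀ ∧ ∃ K₀min : ℕ, ∃ cA : ℕ → ℝ, (∀ K₀, 0 < cA K₀) ∧ ∀ K₀ : ℕ, K₀min ≤ K₀ →
      ∀ (P : HiggsLattice.Params) (_S : Shape P), P.d = d → P.L = L → K₀ ∣ P.M → 3 * K₀ ≤ 2 * P.M →
      ∀ {K : ℕ}, 1 ≤ K → K ≤ P.K → P.mesh K ≤ ε₀ →
      ∀ {r : ℝ}, r * P.mesh K ≤ cA K₀ →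
      ∀ A : HiggsLattice.VecField P K, (∀ x, ‖toSite A x‖ ≤ r) →
        ∀ (g : HiggsLattice.ScalarField P 0 N) (M : ℝ), (∀ x, ‖g x‖ ≤ M) →
          ∀ x, ‖propagatorK C Finset.univ (bgVec mu0sq a K A) msq a K g x‖ ≤ c₀ * P.mesh K ^ 2 * M := by
  obtain ⟨c₀, hc₀, K₀min, cA, hcA, h⟩ := norm_propagatorK_bgVec_le_of_cubes d L hd hL ha hmu hmsq N C ε₀
  exact ⟨c₀, hc₀, K₀min, cA, hcA, fun K₀ hK₀ P S hPd hPL hK₀M h3M K hK1 hK hε r hr A hA g M hg x =>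
    h K₀ hK₀ P S hPd hPL hK₀M hK1 hK (three_half_le_sites hK h3M) hε hr A hA g M hg x⟩

/-- **THE SAME WITH BAŁABAN'S OWN CUBES `K₀ = M`** (the random-walk cubes of [B4] §2 are unions of `2^d` big blocks of the torus
`T^{(K)}_1 = {−ML′_μ ≦ x_μ < ML′_μ}`): *"M sufficiently large"* becomes `M ≧ M_min`, the threshold `c_A(M)`, and the only extra
condition is that a cube is not the whole torus — `K < K_P` or `L′_μ ≧ 2` for every `μ`.
[cite: Balaban1982Higgs1, Prop. 2.1 p.610 «M sufficiently large»; (1.2) p.604] [cite: Balaban1983RegularityDecay, §2 p.575] -/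
theorem norm_propagatorK_bgVec_le_bigBlocks (d L : ℕ) (hd : 1 ≤ d) (hL : Odd L ∧ 1 < L) {a : ℝ} (ha : 0 < a) {mu0sq msq : ℝ}
    (hmu : 0 < mu0sq) (hmsq : 0 < msq) (N : ℕ) (C : ChargeData N) (ε₀ : ℝ) :
    ∃ c₀ : ℝ, 0 < c₀ ∧ ∃ Mmin : ℕ, ∃ cA : ℕ → ℝ, (∀ M, 0 < cA M) ∧
      ∀ (P : HiggsLattice.Params) (_S : Shape P), P.d = d → P.L = L → Mmin ≤ P.M →
      ∀ {K : ℕ}, 1 ≤ K → K ≤ P.K → (K < P.K ∨ ∀ μ, 2 ≤ P.Lp μ) → P.mesh K ≤ ε₀ →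
      ∀ {r : ℝ}, r * P.mesh K ≤ cA P.M →
      ∀ A : HiggsLattice.VecField P K, (∀ x, ‖toSite A x‖ ≤ r) →
        ∀ (g : HiggsLattice.ScalarField P 0 N) (M : ℝ), (∀ x, ‖g x‖ ≤ M) →
          ∀ x, ‖propagatorK C Finset.univ (bgVec mu0sq a K A) msq a K g x‖ ≤ c₀ * P.mesh K ^ 2 * M := by
  obtain ⟨c₀, hc₀, K₀min, cA, hcA, h⟩ := norm_propagatorK_bgVec_le_of_cubes d L hd hL ha hmu hmsq N C ε₀
  refine ⟨c₀, hc₀, K₀min, cA, hcA, fun P S hPd hPL hMmin K hK1 hK hroom hε r hr A hA g M hg x =>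
    h P.M hMmin P S hPd hPL (dvd_refl _) hK1 hK ?_ hε hr A hA g M hg x⟩
  -- `3·L^K·M ≦ 2·L^{K_P}·M·L′_μ`
  intro μ
  have hL3 : 3 ≤ P.L := by
    rw [hPL]; obtain ⟨⟨t, ht⟩, h1⟩ := hL; omega
  unfold half HiggsLattice.Params.sitesPerDir
  have hLp := P.hLp μ
  have hM := P.hM
  rcases hroom with hlt | hLp2
  · have hpow : P.L * P.L ^ K ≤ P.L ^ (P.K - 0) := by
      rw [← pow_succ']; exact Nat.pow_le_pow_right P.hL (by omega)
    calc 3 * (P.L ^ K * P.M) ≤ P.L * (P.L ^ K * P.M) := Nat.mul_le_mul_right _ hL3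
      _ = (P.L * P.L ^ K) * P.M * 1 := by ring
      _ ≤ P.L ^ (P.K - 0) * P.M * P.Lp μ := Nat.mul_le_mul (Nat.mul_le_mul_right _ hpow) hLp
      _ ≤ 2 * (P.L ^ (P.K - 0) * P.M * P.Lp μ) := Nat.le_mul_of_pos_left _ (by norm_num)
  · have hpow : P.L ^ K ≤ P.L ^ (P.K - 0) := Nat.pow_le_pow_right P.hL (by omega)
    have h2 := hLp2 μ
    calc 3 * (P.L ^ K * P.M) ≤ 4 * (P.L ^ K * P.M) := Nat.mul_le_mul_right _ (by norm_num)
      _ = 2 * (P.L ^ K * P.M * 2) := by ring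
      _ ≤ 2 * (P.L ^ (P.K - 0) * P.M * P.Lp μ) :=
          Nat.mul_le_mul_left 2 (Nat.mul_le_mul (Nat.mul_le_mul_right _ hpow) h2)

end Main

/-! ## §3 (3.67)/(E3) on the small-field set with the scalar half `hGs` discharged -/

section E3

/-- **(3.67)/(E3) AT `K ≧ 1` ON THE TORUS SUB-FAMILY, BOTH HALVES DISCHARGED**: p14's `chiW_eq_one_of_smallSet_torus_unif` (vector half at
`A = 0` inside, `K, ε`-free `c₁ = a(c₀ + 1 + (μ₀² + m²)c₀ + ac₀)`) fed with §2's `hGs`: for `d ≧ 1`, odd `L > 1`, `a, μ₀², m² > 0`, `N`, `(e,q)`,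
`ε₀`: constants `c₀ > 0`, `K₀min`, `c_A(K₀) > 0` such that for `K₀ ≧ K₀min`, on every torus `M·L′_μ = L^m` with `K₀ ∣ M`, `3K₀ ≦ 2M`, at every
level `1 ≦ K ≦ K_P` with `L^Kε ≦ min(ε₀, 1)`, for all threshold functions `ℓ, p` with `ℓ_K = L^Kε` and every radius
`r ≦ c₁^{−1}(L^Kε)^{−(d−2)/2}p_K` with `r·L^Kε ≦ c_A(K₀)`: `χ_K(A)χ_K(φ) = 1` on the small-field set `S_r` — the field `hE3` of
`B1LowerBound114Model.Inputs` for such `r`. [cite: Balaban1982Higgs1, (3.67) p.625; (3.27)–(3.29) p.617; Prop. 2.1 (2.25) p.610] -/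
theorem chiW_eq_one_of_smallSet_bgVec (d L : ℕ) (hd : 1 ≤ d) (hL : Odd L ∧ 1 < L) {a : ℝ} (ha : 0 < a) {mu0sq msq : ℝ}
    (hmu : 0 < mu0sq) (hmsq : 0 < msq) (N : ℕ) (C : ChargeData N) (ε₀ : ℝ) :
    ∃ c₀ : ℝ, 0 < c₀ ∧ ∃ K₀min : ℕ, ∃ cA : ℕ → ℝ, (∀ K₀, 0 < cA K₀) ∧ ∀ K₀ : ℕ, K₀min ≤ K₀ →
      ∀ (P : HiggsLattice.Params) (_S : Shape P), P.d = d → P.L = L → K₀ ∣ P.M → 3 * K₀ ≤ 2 * P.M →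
      ∀ {K : ℕ}, 1 ≤ K → K ≤ P.K → P.mesh K ≤ ε₀ → P.mesh K ≤ 1 →
      ∀ (ℓ p : ℕ → ℝ), ℓ K = P.mesh K →
        ∀ {r : ℝ}, r ≤ (a * (c₀ + 1 + (mu0sq + msq) * c₀ + a * c₀))⁻¹ * thrF P.d (P.mesh K) (p K) → r * P.mesh K ≤ cA K₀ →
          ∀ ω ∈ smallSet P N K r, chiW C ℓ p mu0sq msq a K ω.1 ω.2 = 1 := by
  obtain ⟨cv, hcv, hV⟩ := chiW_eq_one_of_smallSet_torus_unif d L hd hL ha hmu hmsq ε₀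
  obtain ⟨c₀, hc₀, K₀min, cA, hcA, hS⟩ := norm_propagatorK_bgVec_le d L hd hL ha hmu hmsq N C ε₀
  refine ⟨max cv c₀, lt_max_of_lt_left hcv, K₀min, cA, hcA, ?_⟩
  intro K₀ hK₀ P S hPd hPL hK₀M h3M K hK1 hK hε hε1 ℓ p hℓK r hr hrA ω hω
  refine hV P S hPd hPL C hK1 hK hε hε1 (le_max_left _ _) ℓ p hℓK hr ?_ ω hω
  intro A hA g M hg x
  have hM : 0 ≤ M := (norm_nonneg _).trans (hg x)
  exact (hS K₀ hK₀ P S hPd hPL hK₀M h3M hK1 hK hε hrA A hA g M hg x).trans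
    (mul_le_mul_of_nonneg_right (mul_le_mul_of_nonneg_right (le_max_right _ _) (sq_nonneg _)) hM)

end E3

end Literature.MathematicalPhysics.QuantumFieldTheory.Balaban1983to89.B1Ineq225BackgroundTorus
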